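import Summits.AtomisticToContinuum.HydrodynamicLimit.Theorems.OneFlightGossipEngineClampedCurrentsDockCubicChannel
import Summits.AtomisticToContinuum.HydrodynamicLimit.Theorems.OneFlightGossipEngineClampedCurrentsDockEntropyStep
import Summits.AtomisticToContinuum.HydrodynamicLimit.Theorems.OneFlightGossipEngineClampedCurrentsDockHeartTools
import Literature.Analysis.FluidPDE.HardSphereFlowJointMeasurable
import HarnessLib

/-!
# The rate cubic channel — the band functional in expectation and the band/top split of the coherent term
# (stub `stub_cubicChannelRate`, line `Sketch`, crux `ClampedTransferDock`, stmt-AtomisticToContinuum-17615)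

Helper file (`--supports stmt-AtomisticToContinuum-17615`, registered sub-goal `band_expectation`) for the registered stub
`stub_cubicChannelRate : CubicChannelRate` (companion file `…ClampedTransferDockCubicChannelRate.lean`, which imports this one).
The line replaces the true-law coherence input S6′ of the heart's cubic channel (`ClampedCurrentsDockCubicChannel.stub_cubicChannel`)
by an entropy bound: the coherent suprathermal cubic content `1{coh} cubHi` of one window is split POINTWISE into its band
`1{coh} cubBand` (`K⋆ < ‖W‖ ≤ K₁`) and its top `cubTop ≤ 8 · (cubic velocity tail above K₁ − U)` (§1, §4), and the band functional
`Y = Σ_i 1{coh_i} cubBand_i` — bounded by `(N+1) K₁³`, measurable on the good set (§2) — is paid IN EXPECTATION UNDER THE TRUE LAW by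
the entropy inequality with respect to the reference local Gibbs law `ψ` at a tilt `γ`, given the reference exponential moment
`∫ exp(γ Y) dψ ≤ e^B`: `E_λ[Y(window from s)] ≤ γ⁻¹ (KL(f_s ‖ ψ) + B)` (§3, `band_expectation`, the landed entropy step
`ClampedCurrentsDockEntropyStep.stub_windowEntropyStep` with zero streaming part and the flow shift on the good set).

prover-line-stmt-AtomisticToContinuum-17615-0 (stub worker `stub_cubicChannelRate`).
-/

noncomputable section

namespace Summit.AtomisticToContinuum.HydrodynamicLimit.Theorems.ClampedTransferDockCubicRate

open scoped BigOperators ENNReal Classical Interval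
open MeasureTheory Filter Set Topology InformationTheory
open Literature.MathematicalPhysics.KineticTheory Literature.Analysis.FluidPDE Literature.Analysis.FunctionSpaces
open Summit.AtomisticToContinuum.HydrodynamicLimit.Theses.OneFlightGossipEngine
open Summit.AtomisticToContinuum.HydrodynamicLimit.Theorems
open Summit.AtomisticToContinuum.HydrodynamicLimit.Theorems.ClampedCurrentsDockCubicChannelPrelim
open Summit.AtomisticToContinuum.HydrodynamicLimit.Theorems.ClampedCurrentsDockCubicChannel
open Summit.AtomisticToContinuum.HydrodynamicLimit.Theorems.EntropyClockDock (ae_mem_good_localGibbsLaw)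
open Summit.AtomisticToContinuum.HydrodynamicLimit.Theorems.HydroLimitInBandContinuity (measurable_flow_of_mem)
open Summit.AtomisticToContinuum.HydrodynamicLimit.Theorems.ClampedCurrentsDockCubicPathwise (intervalIntegrable_orbit)

variable {σ : ℝ} {N : ℕ}

/-! ## §1 Pointwise: the suprathermal cube splits into band and top -/

/-- **Band/top split of the suprathermal cube.** For `‖a‖ ≤ U` and `2U ≤ K₁`:
`1{K⋆ < ‖v − a‖}‖v − a‖³ ≤ 1{K⋆ < ‖v − a‖ ≤ K₁}‖v − a‖³ + 8 · 1{K₁ − U < ‖v‖}‖v‖³` (above the band `‖v‖ > K₁ − U ≥ U ≥ ‖a‖`,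
so `‖v − a‖ ≤ 2‖v‖`). [folklore] -/
theorem hiCube_le_band_add_top {v a : V3} {U Kstar K₁ : ℝ} (ha : ‖a‖ ≤ U) (hK₁ : 2 * U ≤ K₁) :
    (if Kstar < ‖v - a‖ then ‖v - a‖ ^ 3 else 0) ≤
      (if Kstar < ‖v - a‖ ∧ ‖v - a‖ ≤ K₁ then ‖v - a‖ ^ 3 else 0) +
        8 * Set.indicator {w : V3 | K₁ - U < ‖w‖} (fun w => ‖w‖ ^ 3) v := by
  have hI0 : 0 ≤ Set.indicator {w : V3 | K₁ - U < ‖w‖} (fun w => ‖w‖ ^ 3) v :=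
    Set.indicator_nonneg (fun _ _ => by positivity) _
  by_cases h1 : Kstar < ‖v - a‖
  · by_cases h2 : ‖v - a‖ ≤ K₁
    · rw [if_pos h1, if_pos ⟨h1, h2⟩]; linarith
    · rw [if_pos h1, if_neg (fun h => h2 h.2), zero_add]
      have hva : ‖v - a‖ ≤ ‖v‖ + ‖a‖ := norm_sub_le v a
      have hv : K₁ - U < ‖v‖ := by linarith [not_le.1 h2]
      simp only [Set.indicator_of_mem (show v ∈ {w : V3 | K₁ - U < ‖w‖} from hv)]
      have h3 : ‖v - a‖ ≤ 2 * ‖v‖ := by linarith [norm_nonneg a]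
      have h4 : ‖v - a‖ ^ 3 ≤ (2 * ‖v‖) ^ 3 := pow_le_pow_left₀ (norm_nonneg _) h3 3
      nlinarith [h4]
  · rw [if_neg h1]
    have : 0 ≤ (if Kstar < ‖v - a‖ ∧ ‖v - a‖ ≤ K₁ then ‖v - a‖ ^ 3 else 0) := by split_ifs <;> positivity
    linarith

/-- **The band window average lies in `[0, K₁³]`**, whatever the coherence test in front of it. [folklore] -/
theorem ite_bandAvg_mem {w Kstar K₁ : ℝ} (hw : 0 < w) (hK₁ : 0 ≤ K₁) (p : Prop) [Decidable p] (g : ℝ → ℝ)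
    (hg : ∀ r, 0 ≤ g r) :
    0 ≤ (if p then w⁻¹ * ∫ r in (0 : ℝ)..w, (if Kstar < g r ∧ g r ≤ K₁ then g r ^ 3 else 0) else 0) ∧
      (if p then w⁻¹ * ∫ r in (0 : ℝ)..w, (if Kstar < g r ∧ g r ≤ K₁ then g r ^ 3 else 0) else 0) ≤ K₁ ^ 3 := by
  have hg0 : ∀ r, 0 ≤ (if Kstar < g r ∧ g r ≤ K₁ then g r ^ 3 else 0) := fun r => by
    split_ifs <;> [exact pow_nonneg (hg r) 3; exact le_rfl]
  have hgK : ∀ r, (if Kstar < g r ∧ g r ≤ K₁ then g r ^ 3 else 0) ≤ K₁ ^ 3 := fun r => by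
    split_ifs with h <;> [exact pow_le_pow_left₀ (hg r) h.2 3; exact pow_nonneg hK₁ 3]
  have h0 : 0 ≤ ∫ r in (0 : ℝ)..w, (if Kstar < g r ∧ g r ≤ K₁ then g r ^ 3 else 0) :=
    intervalIntegral.integral_nonneg hw.le fun r _ => hg0 r
  have h1 : ∫ r in (0 : ℝ)..w, (if Kstar < g r ∧ g r ≤ K₁ then g r ^ 3 else 0) ≤ K₁ ^ 3 * w := by
    have h := intervalIntegral.norm_integral_le_of_norm_le_const (a := (0 : ℝ)) (b := w) (C := K₁ ^ 3)
      (f := fun r => (if Kstar < g r ∧ g r ≤ K₁ then g r ^ 3 else 0)) fun r _ => by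
        rw [Real.norm_of_nonneg (hg0 r)]; exact hgK r
    rwa [sub_zero, abs_of_pos hw, Real.norm_of_nonneg h0] at h
  by_cases hp : p
  · rw [if_pos hp]
    refine ⟨mul_nonneg (inv_nonneg.2 hw.le) h0, ?_⟩
    rw [inv_mul_le_iff₀ hw, mul_comm]
    exact h1
  · rw [if_neg hp]
    exact ⟨le_rfl, pow_nonneg hK₁ 3⟩

/-! ## §2 Window integrals along the flow: shifts and measurability on the good set -/

variable (Φ : HardSphereFlow (Torus.geometry (Fin 3)) (hsDiameter σ N) (N + 1)) {z : Config (N + 1) (Fin 3) T3}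

/-- Flow shift of the peculiar third moment (explicit form). [folklore] -/
theorem shift_cube' (hz : z ∈ Φ.good) (us : T3 → V3) (i : Fin (N + 1)) (s w : ℝ) :
    ∫ r in (0 : ℝ)..w, ‖(Φ.flow r (Φ.flow s z) i).2 - us (Φ.flow r (Φ.flow s z) i).1‖ ^ 3 =
      ∫ r in s..(s + w), ‖(Φ.flow r z i).2 - us (Φ.flow r z i).1‖ ^ 3 :=
  integral_window_shift Φ hz (fun c => ‖(c i).2 - us (c i).1‖ ^ 3) s w

/-- Flow shift of the band-restricted peculiar third moment. [folklore] -/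
theorem shift_band (hz : z ∈ Φ.good) (us : T3 → V3) (Kstar K₁ : ℝ) (i : Fin (N + 1)) (s w : ℝ) :
    ∫ r in (0 : ℝ)..w, (if Kstar < ‖(Φ.flow r (Φ.flow s z) i).2 - us (Φ.flow r (Φ.flow s z) i).1‖ ∧
        ‖(Φ.flow r (Φ.flow s z) i).2 - us (Φ.flow r (Φ.flow s z) i).1‖ ≤ K₁ then
        ‖(Φ.flow r (Φ.flow s z) i).2 - us (Φ.flow r (Φ.flow s z) i).1‖ ^ 3 else 0) =
      ∫ r in s..(s + w), (if Kstar < ‖(Φ.flow r z i).2 - us (Φ.flow r z i).1‖ ∧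
        ‖(Φ.flow r z i).2 - us (Φ.flow r z i).1‖ ≤ K₁ then ‖(Φ.flow r z i).2 - us (Φ.flow r z i).1‖ ^ 3 else 0) :=
  integral_window_shift Φ hz (fun c => if Kstar < ‖(c i).2 - us (c i).1‖ ∧ ‖(c i).2 - us (c i).1‖ ≤ K₁ then
    ‖(c i).2 - us (c i).1‖ ^ 3 else 0) s w

/-- Flow shift of the weighted transport with a general radial weight `Rw`. [folklore] -/
theorem shift_Qw (hz : z ∈ Φ.good) (us : T3 → V3) (Rw : T3 → ℝ → ℝ) (i : Fin (N + 1)) (s w : ℝ) :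
    ∫ r in (0 : ℝ)..w, (Rw (Φ.flow r (Φ.flow s z) i).1 (‖(Φ.flow r (Φ.flow s z) i).2 - us (Φ.flow r (Φ.flow s z) i).1‖ ^ 2)) •
        ((Φ.flow r (Φ.flow s z) i).2 - us (Φ.flow r (Φ.flow s z) i).1) =
      ∫ r in s..(s + w), (Rw (Φ.flow r z i).1 (‖(Φ.flow r z i).2 - us (Φ.flow r z i).1‖ ^ 2)) •
        ((Φ.flow r z i).2 - us (Φ.flow r z i).1) :=
  integral_window_shift Φ hz (fun c => (Rw (c i).1 (‖(c i).2 - us (c i).1‖ ^ 2)) • ((c i).2 - us (c i).1)) s w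

/-- **Window integrals of a strongly measurable observable along the flow are measurable on the good set** (joint
measurability of the flow on `Φ.good × ℝ`, `HardSphereFlow.measurable_flow_prod_torus`, and Fubini measurability on the two
pieces of `intervalIntegral`). [folklore] -/
theorem measurable_windowIntegral {E : Type*} [NormedAddCommGroup E] [NormedSpace ℝ E] [SecondCountableTopology E]
    [MeasurableSpace E] [BorelSpace E] {f : Config (N + 1) (Fin 3) T3 → E} (hf : StronglyMeasurable f) (a b : ℝ) :
    Measurable fun z : Φ.good => ∫ r in a..b, f (Φ.flow r (z : Config (N + 1) (Fin 3) T3)) := by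
  -- adapted from `ClampedCurrentsDockEntropyStep.measurable_intervalIntegral_comp_flow_apply`
  have key : ∀ (ν : Measure ℝ) [SFinite ν],
      Measurable fun z : Φ.good => ∫ r, f (Φ.flow r (z : Config (N + 1) (Fin 3) T3)) ∂ν := fun ν _ =>
    ((hf.comp_measurable Φ.measurable_flow_prod_torus).integral_prod_right' (ν := ν)).measurable
  simp only [intervalIntegral]
  exact (key _).sub (key _)

/-- Along a good orbit the cubic velocity tail of one particle is interval integrable. [folklore] -/
theorem intervalIntegrable_tail (hz : z ∈ Φ.good) (M : ℝ) (i : Fin (N + 1)) (a b : ℝ) :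
    IntervalIntegrable (fun r => Set.indicator {v : V3 | M < ‖v‖} (fun v => ‖v‖ ^ 3) (Φ.flow r z i).2) volume a b := by
  -- adapted from `ClampedCurrentsDockCubicChannel.pathwiseWindowBound`
  have hv3i : IntervalIntegrable (fun r => ‖(Φ.flow r z i).2‖ ^ 3) volume a b :=
    intervalIntegrable_orbit Φ hz (F := fun y : T3 × V3 => ‖y.2‖ ^ 3) (by fun_prop) i a b
  refine hv3i.mono_fun ?_ (Eventually.of_forall fun r => ?_)
  · exact ((((measurable_norm.pow_const 3).indicator (measurableSet_lt measurable_const measurable_norm)).comp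
      ((measurable_pi_apply i).comp (measurable_flow_of_mem Φ hz)).snd)).aestronglyMeasurable
  · show ‖Set.indicator {v : V3 | M < ‖v‖} (fun v => ‖v‖ ^ 3) (Φ.flow r z i).2‖ ≤ ‖‖(Φ.flow r z i).2‖ ^ 3‖
    rw [Real.norm_of_nonneg (Set.indicator_nonneg (fun _ _ => by positivity) _), Real.norm_of_nonneg (by positivity)]
    exact Set.indicator_le_self' (fun _ _ => by positivity) _

/-- Along a good orbit the suprathermal and the band-restricted peculiar cubes of one particle are interval integrable
(measurable in time, dominated by the peculiar cube). [folklore] -/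
theorem intervalIntegrable_hiCube_band (hz : z ∈ Φ.good) {us : T3 → V3} (huc : Continuous us) (Kstar K₁ : ℝ)
    (i : Fin (N + 1)) (a b : ℝ) :
    IntervalIntegrable (fun r => if Kstar < ‖(Φ.flow r z i).2 - us (Φ.flow r z i).1‖ then
        ‖(Φ.flow r z i).2 - us (Φ.flow r z i).1‖ ^ 3 else 0) volume a b ∧
      IntervalIntegrable (fun r => if Kstar < ‖(Φ.flow r z i).2 - us (Φ.flow r z i).1‖ ∧
        ‖(Φ.flow r z i).2 - us (Φ.flow r z i).1‖ ≤ K₁ then ‖(Φ.flow r z i).2 - us (Φ.flow r z i).1‖ ^ 3 else 0) volume a b := by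
  have hmeas : Measurable fun r => Φ.flow r z i := (measurable_pi_apply i).comp (measurable_flow_of_mem Φ hz)
  have hWm : Measurable fun r => (Φ.flow r z i).2 - us (Φ.flow r z i).1 := hmeas.snd.sub (huc.measurable.comp hmeas.fst)
  have hW3i : IntervalIntegrable (fun r => ‖(Φ.flow r z i).2 - us (Φ.flow r z i).1‖ ^ 3) volume a b :=
    intervalIntegrable_orbit Φ hz (F := fun y : T3 × V3 => ‖y.2 - us y.1‖ ^ 3) (by fun_prop) i a b
  refine ⟨hW3i.mono_fun ?_ (Eventually.of_forall fun r => ?_), hW3i.mono_fun ?_ (Eventually.of_forall fun r => ?_)⟩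
  · exact (Measurable.ite (measurableSet_lt measurable_const hWm.norm) (hWm.norm.pow_const 3)
      measurable_const).aestronglyMeasurable
  · dsimp only
    rw [Real.norm_of_nonneg (by split_ifs <;> positivity), Real.norm_of_nonneg (by positivity)]
    split_ifs <;> [exact le_rfl; positivity]
  · exact (Measurable.ite ((measurableSet_lt measurable_const hWm.norm).inter (measurableSet_le hWm.norm measurable_const))
      (hWm.norm.pow_const 3) measurable_const).aestronglyMeasurable
  · dsimp only
    rw [Real.norm_of_nonneg (by split_ifs <;> positivity), Real.norm_of_nonneg (by positivity)]
    split_ifs <;> [exact le_rfl; positivity]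

/-! ## §3 The band functional in expectation under the true law -/

/-- **The band functional in expectation under the TRUE law, by the entropy inequality** (registered sub-goal
`band_expectation` of line `Sketch`, crux `ClampedTransferDock`, stmt-17615). With the peculiar velocity `W_i(r, z) = v_i(r) − u(x_i(r))`
along the flow from `z`, a measurable radial weight `Rw`, the coherence test `η · cub_i < ‖q̄_i‖` and the band content
`cubBand_i = w⁻¹ ∫ 1{K⋆ < ‖W_i‖ ≤ K₁}‖W_i‖³`, the functional `Y = Σ_i 1{coh_i} cubBand_i` of the window `[0, w]` is bounded by
`(N+1) K₁³` and agrees on the good set with a measurable function; if the reference law `ψ = localGibbsLaw σ b u ϑ N Φ` carries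
`∫ exp(γ Y) dψ ≤ e^B`, then under the true law `λ = localGibbsLaw σ a₀ u₀ θ₀ N Φ` the same functional of the window `[s, s + w]`
(which is `Y ∘ Φ_s` on the good set) has `E_λ ≤ γ⁻¹ (KL(f_s ‖ ψ) + B)` — the landed entropy step
`ClampedCurrentsDockEntropyStep.stub_windowEntropyStep` with zero streaming part. [cite: Yau1991, §2] -/
theorem band_expectation : ∀ {σ : ℝ} {N : ℕ} (Φ : HardSphereFlow (Torus.geometry (Fin 3)) (hsDiameter σ N) (N + 1))
    {a₀ θ₀ b ϑ : T3 → ℝ} {u₀ us : T3 → V3} {Rw : T3 → ℝ → ℝ} {Kstar K₁ η γ B s w : ℝ},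
    0 < σ → σ < 1 / 2 → Continuous a₀ → Continuous θ₀ → Continuous u₀ → (∀ x, 0 < a₀ x) → (∀ x, 0 < θ₀ x) →
    Continuous b → Continuous ϑ → Continuous us → (∀ x, 0 < b x) → (∀ x, 0 < ϑ x) →
    Measurable (fun p : T3 × ℝ => Rw p.1 p.2) → 0 ≤ K₁ → 0 ≤ s → 0 < w → 0 < γ →
    ∫⁻ z, ENNReal.ofReal (Real.exp (γ * ∑ i : Fin (N + 1),
        (if η * (w⁻¹ * ∫ r in (0 : ℝ)..w, ‖(Φ.flow r z i).2 - us (Φ.flow r z i).1‖ ^ 3) <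
            ‖w⁻¹ • ∫ r in (0 : ℝ)..w, (Rw (Φ.flow r z i).1 (‖(Φ.flow r z i).2 - us (Φ.flow r z i).1‖ ^ 2)) •
              ((Φ.flow r z i).2 - us (Φ.flow r z i).1)‖ then
          w⁻¹ * ∫ r in (0 : ℝ)..w, (if Kstar < ‖(Φ.flow r z i).2 - us (Φ.flow r z i).1‖ ∧
            ‖(Φ.flow r z i).2 - us (Φ.flow r z i).1‖ ≤ K₁ then ‖(Φ.flow r z i).2 - us (Φ.flow r z i).1‖ ^ 3 else 0)
        else 0))) ∂(localGibbsLaw σ b us ϑ N Φ) ≤ ENNReal.ofReal (Real.exp B) →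
    ∫⁻ z, ENNReal.ofReal (∑ i : Fin (N + 1),
        (if η * (w⁻¹ * ∫ r in s..(s + w), ‖(Φ.flow r z i).2 - us (Φ.flow r z i).1‖ ^ 3) <
            ‖w⁻¹ • ∫ r in s..(s + w), (Rw (Φ.flow r z i).1 (‖(Φ.flow r z i).2 - us (Φ.flow r z i).1‖ ^ 2)) •
              ((Φ.flow r z i).2 - us (Φ.flow r z i).1)‖ then
          w⁻¹ * ∫ r in s..(s + w), (if Kstar < ‖(Φ.flow r z i).2 - us (Φ.flow r z i).1‖ ∧
            ‖(Φ.flow r z i).2 - us (Φ.flow r z i).1‖ ≤ K₁ then ‖(Φ.flow r z i).2 - us (Φ.flow r z i).1‖ ^ 3 else 0)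
        else 0)) ∂(localGibbsLaw σ a₀ u₀ θ₀ N Φ) ≤
      ENNReal.ofReal (γ⁻¹ * ((klDiv (Φ.lawAt (localGibbsLaw σ a₀ u₀ θ₀ N Φ) s) (localGibbsLaw σ b us ϑ N Φ)).toReal + B)) := by
  intro σ N Φ a₀ θ₀ b ϑ u₀ us Rw Kstar K₁ η γ B s w hσ hσ2 ha hθ hu ha0 hθ0 hb hϑ huc hb0 hϑ0 hRw hK₁ hs hw hγ hB
  haveI := isProbabilityMeasure_localGibbsLaw ha hθ hu ha0 hθ0 hσ2.le N Φ
  -- the band functional of the window `[0, w]`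
  set Y0 : Config (N + 1) (Fin 3) T3 → ℝ := fun z => ∑ i : Fin (N + 1),
      (if η * (w⁻¹ * ∫ r in (0 : ℝ)..w, ‖(Φ.flow r z i).2 - us (Φ.flow r z i).1‖ ^ 3) <
          ‖w⁻¹ • ∫ r in (0 : ℝ)..w, (Rw (Φ.flow r z i).1 (‖(Φ.flow r z i).2 - us (Φ.flow r z i).1‖ ^ 2)) •
            ((Φ.flow r z i).2 - us (Φ.flow r z i).1)‖ then
        w⁻¹ * ∫ r in (0 : ℝ)..w, (if Kstar < ‖(Φ.flow r z i).2 - us (Φ.flow r z i).1‖ ∧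
          ‖(Φ.flow r z i).2 - us (Φ.flow r z i).1‖ ≤ K₁ then ‖(Φ.flow r z i).2 - us (Φ.flow r z i).1‖ ^ 3 else 0)
      else 0) with hY0
  -- it is bounded by `(N+1) K₁³` and nonnegative
  have hY0bd : ∀ z, 0 ≤ Y0 z ∧ Y0 z ≤ ((N : ℝ) + 1) * K₁ ^ 3 := by
    intro z
    simp only [hY0]
    refine ⟨Finset.sum_nonneg fun i _ => (ite_bandAvg_mem hw hK₁ _ _ fun r => norm_nonneg _).1, ?_⟩
    calc _ ≤ ∑ _i : Fin (N + 1), K₁ ^ 3 := Finset.sum_le_sum fun i _ => (ite_bandAvg_mem hw hK₁ _ _ fun r => norm_nonneg _).2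
      _ = ((N : ℝ) + 1) * K₁ ^ 3 := by
          rw [Finset.sum_const, Finset.card_univ, Fintype.card_fin, nsmul_eq_mul]; push_cast; ring
  -- it is measurable on the good set
  have hmW : ∀ i : Fin (N + 1), Measurable fun c : Config (N + 1) (Fin 3) T3 => (c i).2 - us (c i).1 := fun i =>
    (measurable_pi_apply i).snd.sub (huc.measurable.comp (measurable_pi_apply i).fst)
  have hcub : ∀ i : Fin (N + 1), Measurable fun z : Φ.good =>
      ∫ r in (0 : ℝ)..w, ‖(Φ.flow r z i).2 - us (Φ.flow r z i).1‖ ^ 3 := fun i =>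
    measurable_windowIntegral Φ (f := fun c => ‖(c i).2 - us (c i).1‖ ^ 3) ((hmW i).norm.pow_const 3).stronglyMeasurable 0 w
  have hQ : ∀ i : Fin (N + 1), Measurable fun z : Φ.good => ∫ r in (0 : ℝ)..w,
      (Rw (Φ.flow r z i).1 (‖(Φ.flow r z i).2 - us (Φ.flow r z i).1‖ ^ 2)) • ((Φ.flow r z i).2 - us (Φ.flow r z i).1) :=
    fun i => measurable_windowIntegral Φ (f := fun c => (Rw (c i).1 (‖(c i).2 - us (c i).1‖ ^ 2)) • ((c i).2 - us (c i).1))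
      ((hRw.comp ((measurable_pi_apply i).fst.prodMk ((hmW i).norm.pow_const 2))).smul (hmW i)).stronglyMeasurable 0 w
  have hband : ∀ i : Fin (N + 1), Measurable fun z : Φ.good => ∫ r in (0 : ℝ)..w,
      (if Kstar < ‖(Φ.flow r z i).2 - us (Φ.flow r z i).1‖ ∧ ‖(Φ.flow r z i).2 - us (Φ.flow r z i).1‖ ≤ K₁ then
        ‖(Φ.flow r z i).2 - us (Φ.flow r z i).1‖ ^ 3 else 0) := fun i =>
    measurable_windowIntegral Φ (f := fun c => if Kstar < ‖(c i).2 - us (c i).1‖ ∧ ‖(c i).2 - us (c i).1‖ ≤ K₁ then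
      ‖(c i).2 - us (c i).1‖ ^ 3 else 0) (Measurable.ite ((measurableSet_lt measurable_const (hmW i).norm).inter
        (measurableSet_le (hmW i).norm measurable_const)) ((hmW i).norm.pow_const 3) measurable_const).stronglyMeasurable 0 w
  have hterm : ∀ i : Fin (N + 1), Measurable fun z : Φ.good =>
      (if η * (w⁻¹ * ∫ r in (0 : ℝ)..w, ‖(Φ.flow r z i).2 - us (Φ.flow r z i).1‖ ^ 3) <
          ‖w⁻¹ • ∫ r in (0 : ℝ)..w, (Rw (Φ.flow r z i).1 (‖(Φ.flow r z i).2 - us (Φ.flow r z i).1‖ ^ 2)) •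
            ((Φ.flow r z i).2 - us (Φ.flow r z i).1)‖ then
        w⁻¹ * ∫ r in (0 : ℝ)..w, (if Kstar < ‖(Φ.flow r z i).2 - us (Φ.flow r z i).1‖ ∧
          ‖(Φ.flow r z i).2 - us (Φ.flow r z i).1‖ ≤ K₁ then ‖(Φ.flow r z i).2 - us (Φ.flow r z i).1‖ ^ 3 else 0)
      else 0) := fun i =>
    Measurable.ite (measurableSet_lt (((hcub i).const_mul w⁻¹).const_mul η) ((hQ i).const_smul w⁻¹).norm)
      ((hband i).const_mul w⁻¹) measurable_const
  have hY0g : Measurable fun z : Φ.good => Y0 z := Finset.measurable_sum _ fun i _ => hterm i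
  obtain ⟨Ym, hYm, hYmeq⟩ := ClampedCurrentsDockHeart.exists_measurable_eqOn_good Φ hY0g
  -- the entropy step with zero streaming part
  have hB' : ∫⁻ z, ENNReal.ofReal (Real.exp (γ * ((∑ i : Fin (N + 1), w⁻¹ * ∫ r in (0 : ℝ)..w,
      (fun _ : T3 × V3 => (0 : ℝ)) (Φ.flow r z i)) + Y0 z))) ∂(localGibbsLaw σ b us ϑ N Φ) ≤
      ENNReal.ofReal (Real.exp B) := by
    simpa only [hY0, intervalIntegral.integral_zero, mul_zero, Finset.sum_const_zero, zero_add] using hB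
  obtain ⟨hI, hle⟩ := ClampedCurrentsDockEntropyStep.stub_windowEntropyStep σ N Φ a₀ θ₀ u₀ b ϑ us (fun _ => 0) Y0 Ym 0
    (((N : ℝ) + 1) * K₁ ^ 3) γ B s w hσ hσ2 ha hθ hu ha0 hθ0 hb hϑ huc hb0 hϑ0 continuous_const (fun y => by simp) hYm
    hYmeq (fun z _ => by rw [abs_of_nonneg (hY0bd z).1]; exact (hY0bd z).2) hs hw hγ hB'
  simp only [intervalIntegral.integral_zero, mul_zero, Finset.sum_const_zero, zero_add] at hI hle
  -- the band functional of the window `[s, s+w]` is `Y0 ∘ Φ_s` on the good set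
  have key : ∫⁻ z, ENNReal.ofReal (Y0 (Φ.flow s z)) ∂(localGibbsLaw σ a₀ u₀ θ₀ N Φ) ≤ ENNReal.ofReal (γ⁻¹ *
      ((klDiv (Φ.lawAt (localGibbsLaw σ a₀ u₀ θ₀ N Φ) s) (localGibbsLaw σ b us ϑ N Φ)).toReal + B)) := by
    rw [← ofReal_integral_eq_lintegral_ofReal hI (ae_of_all _ fun z => (hY0bd _).1)]
    exact ENNReal.ofReal_le_ofReal hle
  refine le_of_eq_of_le (lintegral_congr_ae ?_) key
  filter_upwards [ae_mem_good_localGibbsLaw σ a₀ θ₀ u₀ N Φ] with z hz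
  simp only [hY0, shift_cube' Φ hz, shift_band Φ hz, shift_Qw Φ hz]

/-! ## §4 The coherent term of one window in mean: band + top -/

/-- **Pathwise band/top split of the coherent term of one particle** on a good orbit: for `‖u‖ ≤ U`, `2U ≤ K₁`,
`1{coh} cubHi ≤ 1{coh} cubBand + 8 w⁻¹ ∫_s^{s+w} 1{K₁ − U < ‖v‖}‖v‖³` (integrate `hiCube_le_band_add_top` in time; the top is
nonnegative, so the coherence test in front of it may be dropped). [folklore] -/
theorem coh_term_le (hz : z ∈ Φ.good) {us : T3 → V3} {Rw : T3 → ℝ → ℝ} {Kstar K₁ U η s w : ℝ} (hUK : 2 * U ≤ K₁)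
    (hw : 0 < w) (huc : Continuous us) (hule : ∀ x, ‖us x‖ ≤ U) (i : Fin (N + 1)) :
    (if η * (w⁻¹ * ∫ r in s..(s + w), ‖(Φ.flow r z i).2 - us (Φ.flow r z i).1‖ ^ 3) <
        ‖w⁻¹ • ∫ r in s..(s + w), (Rw (Φ.flow r z i).1 (‖(Φ.flow r z i).2 - us (Φ.flow r z i).1‖ ^ 2)) •
          ((Φ.flow r z i).2 - us (Φ.flow r z i).1)‖ then
      w⁻¹ * ∫ r in s..(s + w), (if Kstar < ‖(Φ.flow r z i).2 - us (Φ.flow r z i).1‖ then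
        ‖(Φ.flow r z i).2 - us (Φ.flow r z i).1‖ ^ 3 else 0) else 0) ≤
      (if η * (w⁻¹ * ∫ r in s..(s + w), ‖(Φ.flow r z i).2 - us (Φ.flow r z i).1‖ ^ 3) <
          ‖w⁻¹ • ∫ r in s..(s + w), (Rw (Φ.flow r z i).1 (‖(Φ.flow r z i).2 - us (Φ.flow r z i).1‖ ^ 2)) •
            ((Φ.flow r z i).2 - us (Φ.flow r z i).1)‖ then
        w⁻¹ * ∫ r in s..(s + w), (if Kstar < ‖(Φ.flow r z i).2 - us (Φ.flow r z i).1‖ ∧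
          ‖(Φ.flow r z i).2 - us (Φ.flow r z i).1‖ ≤ K₁ then ‖(Φ.flow r z i).2 - us (Φ.flow r z i).1‖ ^ 3 else 0) else 0) +
      8 * (w⁻¹ * ∫ r in s..(s + w), Set.indicator {v : V3 | K₁ - U < ‖v‖} (fun v => ‖v‖ ^ 3) (Φ.flow r z i).2) := by
  have hsw : s ≤ s + w := by linarith
  obtain ⟨hHi, hBi⟩ := intervalIntegrable_hiCube_band Φ hz huc Kstar K₁ i s (s + w)
  have hTi := intervalIntegrable_tail Φ hz (K₁ - U) i s (s + w)
  have hint : ∫ r in s..(s + w), (if Kstar < ‖(Φ.flow r z i).2 - us (Φ.flow r z i).1‖ then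
      ‖(Φ.flow r z i).2 - us (Φ.flow r z i).1‖ ^ 3 else 0) ≤
      (∫ r in s..(s + w), (if Kstar < ‖(Φ.flow r z i).2 - us (Φ.flow r z i).1‖ ∧
        ‖(Φ.flow r z i).2 - us (Φ.flow r z i).1‖ ≤ K₁ then ‖(Φ.flow r z i).2 - us (Φ.flow r z i).1‖ ^ 3 else 0)) +
        8 * ∫ r in s..(s + w), Set.indicator {v : V3 | K₁ - U < ‖v‖} (fun v => ‖v‖ ^ 3) (Φ.flow r z i).2 := by
    rw [← intervalIntegral.integral_const_mul, ← intervalIntegral.integral_add hBi (hTi.const_mul 8)]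
    exact intervalIntegral.integral_mono_on hsw hHi (hBi.add (hTi.const_mul 8)) fun r _ =>
      hiCube_le_band_add_top (hule _) hUK
  have hI0 : 0 ≤ ∫ r in s..(s + w), Set.indicator {v : V3 | K₁ - U < ‖v‖} (fun v => ‖v‖ ^ 3) (Φ.flow r z i).2 :=
    intervalIntegral.integral_nonneg hsw fun r _ => Set.indicator_nonneg (fun _ _ => by positivity) _
  have hw' : 0 ≤ w⁻¹ := inv_nonneg.2 hw.le
  split_ifs
  · calc _ ≤ w⁻¹ * ((∫ r in s..(s + w), (if Kstar < ‖(Φ.flow r z i).2 - us (Φ.flow r z i).1‖ ∧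
          ‖(Φ.flow r z i).2 - us (Φ.flow r z i).1‖ ≤ K₁ then ‖(Φ.flow r z i).2 - us (Φ.flow r z i).1‖ ^ 3 else 0)) +
          8 * ∫ r in s..(s + w), Set.indicator {v : V3 | K₁ - U < ‖v‖} (fun v => ‖v‖ ^ 3) (Φ.flow r z i).2) :=
          mul_le_mul_of_nonneg_left hint hw'
      _ = _ := by ring
  · nlinarith [mul_nonneg hw' hI0]

/-- **The coherent term of one window in mean: band + top.** Under the true law `λ`, if the band functional of the window
`[s, s+w]` has `E_λ ≤ BY` and the per-time cubic velocity tails above `K₁ − U` are `≤ eT` on the window, then the S6′-functional of the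
heart's cubic channel, `(N+1)⁻¹ Σ_i 1{coh_i} cubHi_i`, has `E_λ ≤ (N+1)⁻¹ BY + 8 eT` (pathwise split `coh_term_le` on the good set,
Tonelli for the tail `ClampedCurrentsDockCubicChannelPrelim.cubicTailWindow`). [folklore] -/
theorem coherent_mean_le {a₀ θ₀ : T3 → ℝ} {u₀ us : T3 → V3} {Rw : T3 → ℝ → ℝ} {Kstar K₁ U η s w eT BY : ℝ}
    (hσ : 0 < σ) (hσ2 : σ < 1 / 2) (ha : Continuous a₀) (hθ : Continuous θ₀) (hu : Continuous u₀)
    (ha0 : ∀ x, 0 < a₀ x) (hθ0 : ∀ x, 0 < θ₀ x) (hUK : 2 * U ≤ K₁) (hw : 0 < w) (heT : 0 ≤ eT) (hBY : 0 ≤ BY)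
    (huc : Continuous us) (hule : ∀ x, ‖us x‖ ≤ U)
    (hTop : ∀ r ∈ Icc s (s + w), ∫⁻ z, ENNReal.ofReal (((N : ℝ) + 1)⁻¹ * ∑ i : Fin (N + 1),
        Set.indicator {v : V3 | K₁ - U < ‖v‖} (fun v => ‖v‖ ^ 3) ((Φ.flow r z i).2)) ∂(localGibbsLaw σ a₀ u₀ θ₀ N Φ) ≤
        ENNReal.ofReal eT)
    (hBand : ∫⁻ z, ENNReal.ofReal (∑ i : Fin (N + 1),
        (if η * (w⁻¹ * ∫ r in s..(s + w), ‖(Φ.flow r z i).2 - us (Φ.flow r z i).1‖ ^ 3) <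
            ‖w⁻¹ • ∫ r in s..(s + w), (Rw (Φ.flow r z i).1 (‖(Φ.flow r z i).2 - us (Φ.flow r z i).1‖ ^ 2)) •
              ((Φ.flow r z i).2 - us (Φ.flow r z i).1)‖ then
          w⁻¹ * ∫ r in s..(s + w), (if Kstar < ‖(Φ.flow r z i).2 - us (Φ.flow r z i).1‖ ∧
            ‖(Φ.flow r z i).2 - us (Φ.flow r z i).1‖ ≤ K₁ then ‖(Φ.flow r z i).2 - us (Φ.flow r z i).1‖ ^ 3 else 0)
        else 0)) ∂(localGibbsLaw σ a₀ u₀ θ₀ N Φ) ≤ ENNReal.ofReal BY) :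
    ∫⁻ z, ENNReal.ofReal (((N : ℝ) + 1)⁻¹ * ∑ i : Fin (N + 1),
        (if η * (w⁻¹ * ∫ r in s..(s + w), ‖(Φ.flow r z i).2 - us (Φ.flow r z i).1‖ ^ 3) <
            ‖w⁻¹ • ∫ r in s..(s + w), (Rw (Φ.flow r z i).1 (‖(Φ.flow r z i).2 - us (Φ.flow r z i).1‖ ^ 2)) •
              ((Φ.flow r z i).2 - us (Φ.flow r z i).1)‖ then
          w⁻¹ * ∫ r in s..(s + w), (if Kstar < ‖(Φ.flow r z i).2 - us (Φ.flow r z i).1‖ then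
            ‖(Φ.flow r z i).2 - us (Φ.flow r z i).1‖ ^ 3 else 0) else 0)) ∂(localGibbsLaw σ a₀ u₀ θ₀ N Φ) ≤
      ENNReal.ofReal (((N : ℝ) + 1)⁻¹ * BY + 8 * eT) := by
  have hN : (0 : ℝ) < (N : ℝ) + 1 := by positivity
  have hgood := ae_mem_good_localGibbsLaw σ a₀ θ₀ u₀ N Φ
  have hgood' : (localGibbsLaw σ a₀ u₀ θ₀ N Φ) Φ.goodᶜ = 0 := mem_ae_iff.1 hgood
  set P := localGibbsLaw σ a₀ u₀ θ₀ N Φ with hP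
  set T₂ : Config (N + 1) (Fin 3) T3 → ℝ := fun z => ∫ r in s..(s + w), ∑ i : Fin (N + 1),
      Set.indicator {v : V3 | K₁ - U < ‖v‖} (fun v => ‖v‖ ^ 3) ((Φ.flow r z i).2) with hT₂
  set Ys : Config (N + 1) (Fin 3) T3 → ℝ := fun z => ∑ i : Fin (N + 1),
      (if η * (w⁻¹ * ∫ r in s..(s + w), ‖(Φ.flow r z i).2 - us (Φ.flow r z i).1‖ ^ 3) <
          ‖w⁻¹ • ∫ r in s..(s + w), (Rw (Φ.flow r z i).1 (‖(Φ.flow r z i).2 - us (Φ.flow r z i).1‖ ^ 2)) •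
            ((Φ.flow r z i).2 - us (Φ.flow r z i).1)‖ then
        w⁻¹ * ∫ r in s..(s + w), (if Kstar < ‖(Φ.flow r z i).2 - us (Φ.flow r z i).1‖ ∧
          ‖(Φ.flow r z i).2 - us (Φ.flow r z i).1‖ ≤ K₁ then ‖(Φ.flow r z i).2 - us (Φ.flow r z i).1‖ ^ 3 else 0)
      else 0) with hYs
  set S : Config (N + 1) (Fin 3) T3 → ℝ := fun z => ((N : ℝ) + 1)⁻¹ * ∑ i : Fin (N + 1),
      (if η * (w⁻¹ * ∫ r in s..(s + w), ‖(Φ.flow r z i).2 - us (Φ.flow r z i).1‖ ^ 3) <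
          ‖w⁻¹ • ∫ r in s..(s + w), (Rw (Φ.flow r z i).1 (‖(Φ.flow r z i).2 - us (Φ.flow r z i).1‖ ^ 2)) •
            ((Φ.flow r z i).2 - us (Φ.flow r z i).1)‖ then
        w⁻¹ * ∫ r in s..(s + w), (if Kstar < ‖(Φ.flow r z i).2 - us (Φ.flow r z i).1‖ then
          ‖(Φ.flow r z i).2 - us (Φ.flow r z i).1‖ ^ 3 else 0) else 0) with hS
  -- the tail window functional: a.e.-measurable, and its mean by Tonelli
  have hTm : AEMeasurable T₂ P :=
    Φ.aemeasurable_intervalIntegral_comp_flow_torus (f := tailSum N (K₁ - U)) (measurable_tailSum N (K₁ - U)) s (s + w) hgood'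
  have hT := cubicTailWindow σ N Φ a₀ θ₀ u₀ (K₁ - U) eT s w hσ hσ2 ha hθ hu ha0 hθ0 heT hw.le hTop
  -- pathwise split on the good set
  have hpath : ∀ z ∈ Φ.good, S z ≤ ((N : ℝ) + 1)⁻¹ * Ys z + ((N : ℝ) + 1)⁻¹ * (8 * w⁻¹) * T₂ z := by
    intro z hz
    have h1 := Finset.sum_le_sum fun i (_ : i ∈ Finset.univ) =>
      coh_term_le Φ hz (Rw := Rw) (Kstar := Kstar) (η := η) (s := s) hUK hw huc hule i
    rw [Finset.sum_add_distrib, ← Finset.mul_sum, ← Finset.mul_sum,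
      ← intervalIntegral.integral_finsetSum fun i _ => intervalIntegrable_tail Φ hz (K₁ - U) i s (s + w)] at h1
    refine (mul_le_mul_of_nonneg_left h1 (inv_nonneg.2 hN.le)).trans_eq ?_
    simp only [hYs, hT₂]
    ring
  -- in mean
  calc ∫⁻ z, ENNReal.ofReal (S z) ∂P
      ≤ ∫⁻ z, (ENNReal.ofReal (((N : ℝ) + 1)⁻¹) * ENNReal.ofReal (Ys z) +
          ENNReal.ofReal (((N : ℝ) + 1)⁻¹ * (8 * w⁻¹)) * ENNReal.ofReal (T₂ z)) ∂P := by
        refine lintegral_mono_ae ?_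
        filter_upwards [hgood] with z hz
        rw [← ENNReal.ofReal_mul (by positivity), ← ENNReal.ofReal_mul (by positivity)]
        exact (ENNReal.ofReal_le_ofReal (hpath z hz)).trans ENNReal.ofReal_add_le
    _ = ENNReal.ofReal (((N : ℝ) + 1)⁻¹) * ∫⁻ z, ENNReal.ofReal (Ys z) ∂P +
          ENNReal.ofReal (((N : ℝ) + 1)⁻¹ * (8 * w⁻¹)) * ∫⁻ z, ENNReal.ofReal (T₂ z) ∂P := by
        rw [lintegral_add_right' _ ((hTm.ennreal_ofReal.const_mul _)), lintegral_const_mul' _ _ ENNReal.ofReal_ne_top,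
          lintegral_const_mul' _ _ ENNReal.ofReal_ne_top]
    _ ≤ ENNReal.ofReal (((N : ℝ) + 1)⁻¹) * ENNReal.ofReal BY +
          ENNReal.ofReal (((N : ℝ) + 1)⁻¹ * (8 * w⁻¹)) * ENNReal.ofReal (w * ((N : ℝ) + 1) * eT) :=
        add_le_add (mul_le_mul' le_rfl hBand) (mul_le_mul' le_rfl hT)
    _ = ENNReal.ofReal (((N : ℝ) + 1)⁻¹ * BY + 8 * eT) := by
        rw [← ENNReal.ofReal_mul (by positivity), ← ENNReal.ofReal_mul (by positivity),
          ← ENNReal.ofReal_add (by positivity) (by positivity)]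
        congr 1
        field_simp

end Summit.AtomisticToContinuum.HydrodynamicLimit.Theorems.ClampedTransferDockCubicRate

end
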